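import Summits.CriticalPhenomena.SAWScalingLimit.Theses.SAWTargetMonotonicity
import Summits.CriticalPhenomena.SAWScalingLimit.Theorems.SAWTargetMonotonicityFKGGivesDomainMonotone
import Summits.CriticalPhenomena.SAWScalingLimit.Theorems.SAWTargetMonotonicityFKGGivesDomainMonotoneLensOrder
import Summits.CriticalPhenomena.SAWScalingLimit.Theorems.SAWLoopFugacityFlowAssembly

/-!
# Birth skeleton — crux `DomainMonotone` (stmt-CriticalPhenomena-8254)

Route `SAWTargetMonotonicity` of `CriticalPhenomena/SAWScalingLimit`, crux rank 3 ("removing room on the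
`R`-side of `(Ω; a, b)` pushes the critical SAW chord stochastically toward the `P`-side", Hall/Strassen
form in the lens-winding order `γ' ≼ γ :↔ ∀ z, 0 ≤ wind(γ'·γ⁻¹, z)`).

## Line `birth`: DOMAIN MONOTONICITY IS A ONE-VERTEX STATEMENT (peeling + pinning)

Everything is phrased INTRINSICALLY on the chords of the big discrete domain `Ω_δ`
(`Ω = {wind(P·R) ≠ 0} ∩ D`): the removed room only enters through AVOIDANCE EVENTS
`Avoid K = {γ | γ visits no site of K}`, so no intermediate discrete domains (and no "largest
component" pathologies of `meshDomain`) appear.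

* `stub_pinning` (**load-bearing**, XL — the one-vertex form of the crux, strictly weaker than the
  positive association of route `SAWLeftRightFKG`): let `K` be an obstacle whose avoidance event is a
  lens-DOWN-set (a "top-peeled" sub-domain `Ω_δ ∖ K`) and let `v` be EXPOSED above `K` (among the chords
  avoiding `K`, visiting `v` is lens-up-closed — e.g. a site hanging from the upper arc `R` through `K`).
  Then forbidding `v` as well pushes the conditioned chord DOWN, in Hall form:
  `law(Y) · law(Avoid K) ≤ law(Avoid (K ∪ {v})) · law(↑Y ∩ Avoid K)` for every `Y ⊆ Avoid (K ∪ {v})`.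
  (Cheapest falsifier: exact enumeration of single-site pinning covariances `Cov(1_{γ ∋ v}, 1_U)` for
  top-boundary sites `v` and lens-up-sets `U` in ≤ 6×6 boxes at `x_c`.)
* `stub_peeling` (M–L, planar lattice combinatorics + one winding argument): under the crux's typed
  hypotheses for `(P, R)` and `(P, R')` with `Ω' ⊆ Ω`, the sites of `Ω_δ` lost in `Ω'_δ` can be forbidden
  ONE AT A TIME, each exposed at its turn (order the pockets between `R` and `R'` outward from their
  anchors on `R°`), and at the end the chords avoiding them are exactly the chords all of whose edges are
  edges of `Ω'_δ` (the range of the transfer map `chords(Ω'_δ) ↪ chords(Ω_δ)`).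

## Composition (PROVED here, no `sorry` of its own): `DomainMonotone_of`

Induction along the peeling list: lens-down-closedness of `Avoid K` propagates through exposed sites;
the Hall steps of `stub_pinning` compose because the lens relation is TRANSITIVE (tree theorem
`FKGGivesDomainMonotone.lens_trans'`) and start because it is REFLEXIVE (`lens_refl'`), giving
`law_Ω(Y) ≤ law_Ω(E') · law_Ω(↑Y)` for every `Y ⊆ E' :=` "all edges in `Ω'_δ`".  Then the conditioning
identity `law_{Ω'}(A) = law_Ω(Φ '' A) / law_Ω(E')` (tree theorem `exists_transfer`, finiteness of the chord
space from `JordanDomain.isBounded`), an `ℝ≥0∞` cancellation, and the identification of the intrinsic lens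
loop with the crux's `Walk.mapLe` spelling (`toCurve_append_reverse_congr`) close the crux BY NAME.

## Audit record (planner skeleton-register, 2026-08-17; details in `Lines/birth.md`)

* `lean check --json`: rc 0, `sorries = 2` = {`stub_pinning`, `stub_peeling`}, no other `sorry`;
  `#print axioms DomainMonotone_of` = `[propext, sorryAx, Classical.choice, Quot.sound]` (the `sorryAx`
  is the two stubs), `#print axioms dominated_peeled` = `[propext, Classical.choice, Quot.sound]`.
* `#h21_check_skeleton "stmt-CriticalPhenomena-8254" …DomainMonotone stub_pinning stub_peeling`:
  `ok = true`, `codes = []`, theorem `DomainMonotone_of`, both stubs `sorried = true`, `closed = false`.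
* BC3 probes (planner folder `bc/probe_{pinning,peeling}_{crux,summit}.lean`, hypothesis `h` = the
  stub statement verbatim, `first | exact? | simpa using h | aesop`, `maxHeartbeats 400000`):
  `stub_pinning → DomainMonotone` FAIL, `stub_pinning → SAWScalingLimit` FAIL,
  `stub_peeling → DomainMonotone` FAIL, `stub_peeling → SAWScalingLimit` FAIL (4/4 rc 1, "aesop failed,
  made no progress" after `exact?`/`simpa` found nothing).  No stub is cheaply the crux or the summit.
* Disproof used: none — `Cruxes/DomainMonotone/` had no workfiles (`ledger crux ls`: no `Disproof.lean`,
  no `Negative/*`) and `ledger negatives --problem CriticalPhenomena` lists no statement of this shape.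
* What the composition uses from the crux hypotheses: `0 < δ` (lens preorder, finiteness), `a ≠ b` and
  reachability in `Ω_δ` (`a ∈ meshDomain Ω δ` for the transfer map), `Ω' ⊆ Ω` (transfer), `D.isBounded`
  (finiteness); everything else (paths, windings, attachments, reachability in `Ω'_δ`) is handed to the
  stubs through `Typed`.
-/

noncomputable section

open MeasureTheory Set
open scoped ENNReal
open Literature.Probability.LatticeModels
open Literature.Probability.RandomPlanarGeometry
open Literature.Probability.RandomPlanarGeometry.SAW
open Summit.CriticalPhenomena.SAWScalingLimit.Theorems.SAWTargetMonotonicity.FKGGivesDomainMonotone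
  (exists_transfer mem_meshDomain_of_reachable weight_univ_ne_top toCurve_append_reverse_congr
    lens_refl' lens_trans' discreteDomainGraph_adj_zd)

namespace Summit.CriticalPhenomena.SAWScalingLimit.Cruxes.DomainMonotone.Birth

/-! ### Typed data of the crux -/

/-- The lattice point to the LEFT of the dart `u → v` (the crux's `lft`). -/
def lft (u v : Site 2) : Site 2 := u + ![-(v 1 - u 1), v 0 - u 0]

/-- The winding domain of a closed lattice boundary walk `C`, cut by the Jordan domain `D`
(the crux's `Ω = {wind C ≠ 0} ∩ D.carrier`). -/
def dom (D : JordanDomain) (δ : ℝ) {u v : Site 2} (C : (zdGraph 2).Walk u v) : Set ℂ :=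
  {z | Curve.wind ⟨C.toCurve (meshPoint δ)⟩ z ≠ 0} ∩ D.carrier

/-- The crux's typed hypotheses on one boundary `C = P · R` with attached source `a` and target `b`
(verbatim: positive mesh, vertex-simple arcs, winding in `{0, 1}`, `a`/`b` to the left of or straight
behind the first darts of `P`/`R`, `a ≠ b` joined in `Ω_δ`). -/
structure Typed (D : JordanDomain) (δ : ℝ) (a' b' a b : Site 2) (P : (zdGraph 2).Walk a' b')
    (R : (zdGraph 2).Walk b' a') : Prop where
  pos : 0 < δ
  pathP : P.IsPath
  pathR : R.IsPath
  wind01 : ∀ z : ℂ, Curve.wind ⟨(P.append R).toCurve (meshPoint δ)⟩ z = 0 ∨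
    Curve.wind ⟨(P.append R).toCurve (meshPoint δ)⟩ z = 1
  attachA : a = lft a' (P.getVert 1) ∨ a = a' + (a' - P.getVert 1)
  attachB : b = lft b' (R.getVert 1) ∨ b = b' + (b' - R.getVert 1)
  ne : a ≠ b
  reach : (discreteDomainGraph (dom D δ (P.append R)) δ).Reachable a b

/-! ### The intrinsic order calculus on the chords of one discrete domain -/

section Intrinsic

variable {Ω : Set ℂ} {δ : ℝ} {a b : Site 2}

/-- The lens relation `γ₁ ≼ γ₂`: the lens loop `γ₁ · γ₂⁻¹` winds non-negatively about every point
(`γ₂` lies weakly on the `R`-side of `γ₁`; the crux's relation, intrinsic spelling). -/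
def Lens (γ₁ γ₂ : DomainSAW Ω δ a b) : Prop :=
  ∀ z : ℂ, 0 ≤ Curve.wind ⟨(γ₁.walk.append γ₂.walk.reverse).toCurve (meshPoint δ)⟩ z

/-- The upper shadow `↑Y` of an event in the lens relation. -/
def Up (Y : Set (DomainSAW Ω δ a b)) : Set (DomainSAW Ω δ a b) :=
  {γ | ∃ y ∈ Y, Lens y γ}

/-- An event is a lens-down-set. -/
def IsDown (E : Set (DomainSAW Ω δ a b)) : Prop :=
  ∀ γ₁ γ₂ : DomainSAW Ω δ a b, Lens γ₁ γ₂ → γ₂ ∈ E → γ₁ ∈ E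

variable (Ω δ a b)

/-- The avoidance event of an obstacle `K ⊆ ℤ²`: chords visiting no site of `K`. -/
def Avoid (K : Set (Site 2)) : Set (DomainSAW Ω δ a b) :=
  {γ | ∀ v ∈ γ.walk.support, v ∉ K}

/-- The site `v` is EXPOSED above the obstacle `K`: among the chords avoiding `K`, visiting `v` is
lens-up-closed (every chord weakly on the `R`-side of a chord through `v` also passes through `v`). -/
def Exposed (K : Set (Site 2)) (v : Site 2) : Prop :=
  ∀ γ₁ γ₂ : DomainSAW Ω δ a b, γ₁ ∈ Avoid Ω δ a b K → γ₂ ∈ Avoid Ω δ a b K → Lens γ₁ γ₂ →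
    v ∈ γ₁.walk.support → v ∈ γ₂.walk.support

/-- A PEELING CHAIN from the obstacle `K`: the listed sites are forbidden one at a time, each exposed
above the obstacle accumulated so far. -/
def PeelChain : Set (Site 2) → List (Site 2) → Prop
  | _, [] => True
  | K, v :: l => Exposed Ω δ a b K v ∧ PeelChain (insert v K) l

variable {Ω δ a b}

/-- The obstacle accumulated along a list (`peeled K [v₁, …, vₙ] = K ∪ {v₁, …, vₙ}`, recursively). -/
def peeled : Set (Site 2) → List (Site 2) → Set (Site 2)
  | K, [] => K
  | K, v :: l => peeled (insert v K) l

end Intrinsic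

/-! ### The registered stubs -/

/-- STUB 1 (XL, **load-bearing**) — **PINNING**, the one-vertex domain monotonicity.  For typed data and
the big domain `Ω = dom D δ (P·R)`: if avoiding the obstacle `K` is a lens-down-set and `v` is exposed
above `K`, then for every event `Y` of chords avoiding `K ∪ {v}`,
`law(Y) · law(Avoid K) ≤ law(Avoid (K ∪ {v})) · law(↑Y ∩ Avoid K)`
— i.e. `law(· | avoid K ∪ {v}) ≼ law(· | avoid K)` in Hall form: forbidding one exposed site pushes the
conditioned critical chord down. -/
theorem stub_pinning :
    ∀ (D : JordanDomain) (δ : ℝ) (a' b' a b : Site 2) (P : (zdGraph 2).Walk a' b')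
      (R : (zdGraph 2).Walk b' a'), Typed D δ a' b' a b P R →
      ∀ (K : Set (Site 2)) (v : Site 2),
        IsDown (Avoid (dom D δ (P.append R)) δ a b K) →
        Exposed (dom D δ (P.append R)) δ a b K v →
        ∀ Y ⊆ Avoid (dom D δ (P.append R)) δ a b (insert v K),
          law (dom D δ (P.append R)) δ a b Y *
              law (dom D δ (P.append R)) δ a b (Avoid (dom D δ (P.append R)) δ a b K) ≤
            law (dom D δ (P.append R)) δ a b (Avoid (dom D δ (P.append R)) δ a b (insert v K)) *
              law (dom D δ (P.append R)) δ a b (Up Y ∩ Avoid (dom D δ (P.append R)) δ a b K) := by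
  sorry

/-- STUB 2 (M–L) — **PEELING**.  For typed `(P, R)` and `(P, R')` with `Ω' ⊆ Ω` there is a peeling
chain from the empty obstacle (the sites lost in `Ω'_δ` are forbidden one at a time, each exposed at
its turn) after which the chords avoiding the accumulated obstacle are exactly the chords of `Ω_δ` all
of whose edges are edges of `Ω'_δ` (the range of the transfer map `chords(Ω'_δ) ↪ chords(Ω_δ)`). -/
theorem stub_peeling :
    ∀ (D : JordanDomain) (δ : ℝ) (a' b' a b : Site 2) (P : (zdGraph 2).Walk a' b')
      (R R' : (zdGraph 2).Walk b' a'), Typed D δ a' b' a b P R → Typed D δ a' b' a b P R' →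
      dom D δ (P.append R') ⊆ dom D δ (P.append R) →
      ∃ l : List (Site 2), PeelChain (dom D δ (P.append R)) δ a b ∅ l ∧
        Avoid (dom D δ (P.append R)) δ a b (peeled ∅ l) =
          {γ | ∀ e ∈ γ.walk.edges, e ∈ (discreteDomainGraph (dom D δ (P.append R')) δ).edgeSet} := by
  sorry

/-! ### Composition, part 1: the chain calculus (proved) -/

section Chain

variable {Ω : Set ℂ} {δ : ℝ} {a b : Site 2}

/-- The critical law has total mass `0` (junk) or `1`. -/
theorem law_univ_eq_zero_or_one (Ω : Set ℂ) (δ : ℝ) (a b : Site 2) :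
    law Ω δ a b univ = 0 ∨ law Ω δ a b univ = 1 := by
  rw [law, Measure.smul_apply, smul_eq_mul]
  by_cases h0 : weight Ω δ a b univ = 0
  · left; rw [h0, mul_zero]
  by_cases ht : weight Ω δ a b univ = ∞
  · left; rw [ht, ENNReal.inv_top, zero_mul]
  · right; exact ENNReal.inv_mul_cancel h0 ht

/-- Every event has law at most `1`, in particular finite law. -/
theorem law_ne_top (S : Set (DomainSAW Ω δ a b)) : law Ω δ a b S ≠ ∞ := by
  have h : law Ω δ a b S ≤ law Ω δ a b univ := measure_mono (subset_univ S)
  rcases law_univ_eq_zero_or_one Ω δ a b with h0 | h1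
  · rw [h0] at h; exact ne_top_of_le_ne_top ENNReal.zero_ne_top h
  · rw [h1] at h; exact ne_top_of_le_ne_top ENNReal.one_ne_top h

/-- HALL DOMINATION of the `K`-conditioned law by the unconditioned one, intrinsic form:
`law(Y) ≤ law(Avoid K) · law(↑Y)` for every event `Y` of chords avoiding `K`. -/
def Dominated (Ω : Set ℂ) (δ : ℝ) (a b : Site 2) (K : Set (Site 2)) : Prop :=
  ∀ Y ⊆ Avoid Ω δ a b K, law Ω δ a b Y ≤ law Ω δ a b (Avoid Ω δ a b K) * law Ω δ a b (Up Y)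

/-- Avoiding a larger obstacle is a smaller event. -/
theorem avoid_mono {K K' : Set (Site 2)} (h : K ⊆ K') : Avoid Ω δ a b K' ⊆ Avoid Ω δ a b K :=
  fun _ hγ v hv hvK => hγ v hv (h hvK)

/-- Nothing to avoid: `Avoid ∅` is everything. -/
theorem avoid_empty : Avoid Ω δ a b ∅ = univ :=
  eq_univ_of_forall fun _ _ _ h => h

/-- Reflexivity: `Y ⊆ ↑Y` (tree theorem `lens_refl'`). -/
theorem subset_up (hδ : δ ≠ 0) (Y : Set (DomainSAW Ω δ a b)) : Y ⊆ Up Y :=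
  fun γ hγ => ⟨γ, hγ, lens_refl' discreteDomainGraph_adj_zd hδ γ.walk⟩

/-- Transitivity: `↑↑Y ⊆ ↑Y` (tree theorem `lens_trans'`). -/
theorem up_up_subset (hδ : δ ≠ 0) (Y : Set (DomainSAW Ω δ a b)) : Up (Up Y) ⊆ Up Y := by
  rintro γ ⟨y₁, ⟨y, hy, hyy₁⟩, h₁⟩
  exact ⟨y, hy, lens_trans' discreteDomainGraph_adj_zd hδ y.walk y₁.walk γ.walk hyy₁ h₁⟩

/-- `↑` is monotone. -/
theorem up_mono {Y Y' : Set (DomainSAW Ω δ a b)} (h : Y ⊆ Y') : Up Y ⊆ Up Y' := by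
  rintro γ ⟨y, hy, hyγ⟩
  exact ⟨y, h hy, hyγ⟩

/-- Base of the induction: the empty obstacle (total mass `0` or `1`, reflexivity). -/
theorem dominated_empty (hδ : δ ≠ 0) : Dominated Ω δ a b ∅ := by
  intro Y _
  rw [avoid_empty]
  rcases law_univ_eq_zero_or_one Ω δ a b with h0 | h1
  · have hY : law Ω δ a b Y = 0 := measure_mono_null (subset_univ Y) h0
    rw [hY]; exact zero_le
  · rw [h1, one_mul]
    exact measure_mono (subset_up hδ Y)

/-- Down-closedness propagates through an exposed site. -/
theorem isDown_insert {K : Set (Site 2)} {v : Site 2} (hdown : IsDown (Avoid Ω δ a b K))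
    (hexp : Exposed Ω δ a b K v) : IsDown (Avoid Ω δ a b (insert v K)) := by
  intro γ₁ γ₂ h12 h2
  have h2K : γ₂ ∈ Avoid Ω δ a b K := avoid_mono (subset_insert v K) h2
  have h1K : γ₁ ∈ Avoid Ω δ a b K := hdown γ₁ γ₂ h12 h2K
  intro u hu huK
  rcases (mem_insert_iff.1 huK) with h | huK'
  · exact h2 v (hexp γ₁ γ₂ h1K h2K h12 (h ▸ hu)) (mem_insert v K)
  · exact h1K u hu huK'

/-- The inductive step: a Hall step for the exposed site `v` (the shape delivered by `stub_pinning`)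
upgrades domination by `Avoid K` to domination by `Avoid (K ∪ {v})` (transitivity + cancellation). -/
theorem dominated_insert (hδ : δ ≠ 0) {K : Set (Site 2)} {v : Site 2} (hD : Dominated Ω δ a b K)
    (hpin : ∀ Y ⊆ Avoid Ω δ a b (insert v K),
      law Ω δ a b Y * law Ω δ a b (Avoid Ω δ a b K) ≤
        law Ω δ a b (Avoid Ω δ a b (insert v K)) * law Ω δ a b (Up Y ∩ Avoid Ω δ a b K)) :
    Dominated Ω δ a b (insert v K) := by
  intro Y hY
  set E₁ := Avoid Ω δ a b K with hE₁
  set E₂ := Avoid Ω δ a b (insert v K) with hE₂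
  have hsub : E₂ ⊆ E₁ := avoid_mono (subset_insert v K)
  have h1 := hpin Y hY
  -- domination at level `K`, applied to `↑Y ∩ E₁`, then transitivity of the lens relation
  have h2 : law Ω δ a b (Up Y ∩ E₁) ≤ law Ω δ a b E₁ * law Ω δ a b (Up Y) :=
    (hD (Up Y ∩ E₁) inter_subset_right).trans
      (mul_le_mul' le_rfl (measure_mono ((up_mono inter_subset_left).trans (up_up_subset hδ Y))))
  have h3 : law Ω δ a b Y * law Ω δ a b E₁ ≤
      law Ω δ a b E₂ * law Ω δ a b (Up Y) * law Ω δ a b E₁ :=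
    calc law Ω δ a b Y * law Ω δ a b E₁ ≤ law Ω δ a b E₂ * law Ω δ a b (Up Y ∩ E₁) := h1
      _ ≤ law Ω δ a b E₂ * (law Ω δ a b E₁ * law Ω δ a b (Up Y)) := mul_le_mul' le_rfl h2
      _ = law Ω δ a b E₂ * law Ω δ a b (Up Y) * law Ω δ a b E₁ := by ring
  by_cases h0 : law Ω δ a b E₁ = 0
  · have hY0 : law Ω δ a b Y = 0 := measure_mono_null (hY.trans hsub) h0
    rw [hY0]; exact zero_le
  · exact (ENNReal.mul_le_mul_iff_left h0 (law_ne_top E₁)).1 h3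

/-- The chain: domination and down-closedness are carried along any peeling chain, given Hall steps for
exposed sites above down-closed obstacles (the content of `stub_pinning`). -/
theorem dominated_peeled (hδ : δ ≠ 0)
    (hpin : ∀ (K : Set (Site 2)) (v : Site 2), IsDown (Avoid Ω δ a b K) → Exposed Ω δ a b K v →
      ∀ Y ⊆ Avoid Ω δ a b (insert v K),
        law Ω δ a b Y * law Ω δ a b (Avoid Ω δ a b K) ≤
          law Ω δ a b (Avoid Ω δ a b (insert v K)) * law Ω δ a b (Up Y ∩ Avoid Ω δ a b K)) :
    ∀ (l : List (Site 2)) (K : Set (Site 2)), IsDown (Avoid Ω δ a b K) → Dominated Ω δ a b K →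
      PeelChain Ω δ a b K l → Dominated Ω δ a b (peeled K l) := by
  intro l
  induction l with
  | nil => intro K _ hD _; exact hD
  | cons v l ih =>
    intro K hdown hD hchain
    exact ih (insert v K) (isDown_insert hdown hchain.1)
      (dominated_insert hδ hD (hpin K v hdown hchain.1)) hchain.2

end Chain

/-! ### Composition, part 2 (PROVED): stubs ⇒ the crux, by name -/

/-- **The composition** `stub_pinning → stub_peeling → DomainMonotone` (real proof, no `sorry` of its
own; the two stubs enter BY NAME, each exactly once — the A12 skeleton audit admits only name-keyed
obligations, so the crux is concluded by name with no extra hypotheses and `closed` stays `false`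
exactly as long as a stub is sorried; the hypothesis-taking form of the argument is the generic chain
lemma `dominated_peeled`).  Peel (`stub_peeling`), run the chain (`dominated_peeled`, fed by
`stub_pinning`), then condition: `law_{Ω'}(A) = law_Ω(Φ '' A) / law_Ω(range Φ)` (`exists_transfer`)
and cancel in `ℝ≥0∞`; the intrinsic lens loop is the crux's `mapLe` loop by
`toCurve_append_reverse_congr`. -/
theorem DomainMonotone_of :
    Summit.CriticalPhenomena.SAWScalingLimit.Theses.SAWTargetMonotonicity.DomainMonotone := by
  intro D δ a' b' a b P R R' C C' Ω Ω' hle hle' lft' hδ hP hR hR' hw hw' hsub ha hb hb' hab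
    hreach hreach' A
  -- the typed bundles of the two boundaries
  have hT : Typed D δ a' b' a b P R := ⟨hδ, hP, hR, hw, ha, hb, hab, hreach⟩
  have hT' : Typed D δ a' b' a b P R' := ⟨hδ, hP, hR', hw', ha, hb', hab, hreach'⟩
  have hδ0 : δ ≠ 0 := hδ.ne'
  -- peel, then run the chain fed by pinning
  obtain ⟨l, hchain, hfinal⟩ := stub_peeling D δ a' b' a b P R R' hT hT' hsub
  have hdom : Dominated Ω δ a b (peeled ∅ l) :=
    dominated_peeled hδ0 (stub_pinning D δ a' b' a b P R hT) l ∅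
      (by rw [avoid_empty]; exact fun _ _ _ _ => mem_univ _) (dominated_empty hδ0) hchain
  -- the transfer map `Φ : chords(Ω'_δ) ↪ chords(Ω_δ)`; its range is the final avoidance event
  have haΩ : a ∈ meshDomain Ω δ := mem_meshDomain_of_reachable hab hreach
  obtain ⟨Φ, hΦ, hsupp, -, hwΦ, hrange⟩ := exists_transfer (b := b) hsub haΩ
  set w := weight Ω δ a b with hwdef
  have hEeq : Set.range Φ = Avoid (dom D δ (P.append R)) δ a b (peeled ∅ l) := by
    rw [hfinal]; exact Set.ext fun γ => hrange γ
  have hdom' : ∀ Y ⊆ Set.range Φ,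
      law Ω δ a b Y ≤ law Ω δ a b (Set.range Φ) * law Ω δ a b (Up Y) := by
    rw [hEeq]; exact hdom
  -- the target event of the crux contains the upper shadow of `Φ '' A`
  set T : Set (DomainSAW Ω δ a b) := {γ | ∃ γ' ∈ A, ∀ z : ℂ, 0 ≤ Curve.wind
    ⟨((γ'.walk.mapLe hle').append (γ.walk.mapLe hle).reverse).toCurve (meshPoint δ)⟩ z} with hTdef
  have hUpT : Up (Φ '' A) ⊆ T := by
    rintro γ ⟨y, ⟨γ', hγ'A, rfl⟩, hlens⟩
    refine ⟨γ', hγ'A, fun z => ?_⟩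
    have hp : (Φ γ').walk.support = (γ'.walk.mapLe hle').support :=
      (hsupp γ').trans (SimpleGraph.Walk.support_mapLe_eq_support hle' γ'.walk).symm
    have hq : γ.walk.support = (γ.walk.mapLe hle).support :=
      (SimpleGraph.Walk.support_mapLe_eq_support hle γ.walk).symm
    rw [← toCurve_append_reverse_congr (meshPoint δ) hp hq]
    exact hlens z
  -- finiteness of the chord space of the bounded domain `Ω ⊆ D`
  have hΩb : Bornology.IsBounded Ω := D.isBounded.subset fun z hz => hz.2
  haveI : Finite (DomainSAW Ω δ a b) :=
    Summit.CriticalPhenomena.SAWScalingLimit.Theorems.SAWLoopFugacityFlowAssembly.finite_domainSAW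
      hΩb hδ a b
  have hUtop : w univ ≠ ∞ := weight_univ_ne_top
  -- both laws through `w`
  have hAE : Φ '' A ⊆ Set.range Φ := image_subset_range Φ A
  have hlawS : ∀ S : Set (DomainSAW Ω δ a b), law Ω δ a b S = (w univ)⁻¹ * w S := fun S => by
    rw [law, Measure.smul_apply, smul_eq_mul]
  have hlaw' : law Ω' δ a b A = (w (Set.range Φ))⁻¹ * w (Φ '' A) := by
    rw [law, Measure.smul_apply, smul_eq_mul, hwΦ univ, hwΦ A, image_univ]
  have hq : (w univ)⁻¹ * w (Φ '' A) ≤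
      (w univ)⁻¹ * w (Set.range Φ) * ((w univ)⁻¹ * w (Up (Φ '' A))) := by
    have := hdom' (Φ '' A) hAE
    rw [hlawS (Φ '' A), hlawS (Set.range Φ), hlawS (Up (Φ '' A))] at this
    exact this
  have hmono : w (Up (Φ '' A)) ≤ w T := measure_mono hUpT
  show law Ω' δ a b A ≤ law Ω δ a b T
  rw [hlaw', hlawS T]
  -- degenerate case `w (range Φ) = 0`, else cancel
  by_cases hE0 : w (Set.range Φ) = 0
  · have hA0 : w (Φ '' A) = 0 := measure_mono_null hAE hE0
    rw [hA0, mul_zero]; exact zero_le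
  have hEtop : w (Set.range Φ) ≠ ∞ := measure_ne_top_of_subset (subset_univ _) hUtop
  have hU0 : w univ ≠ 0 := fun h0 => hE0 (measure_mono_null (subset_univ _) h0)
  calc (w (Set.range Φ))⁻¹ * w (Φ '' A)
      = (w (Set.range Φ))⁻¹ * w (Φ '' A) * ((w univ)⁻¹ * w univ) := by
        rw [ENNReal.inv_mul_cancel hU0 hUtop, mul_one]
    _ = ((w (Set.range Φ))⁻¹ * w univ) * ((w univ)⁻¹ * w (Φ '' A)) := by ring
    _ ≤ ((w (Set.range Φ))⁻¹ * w univ) *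
          ((w univ)⁻¹ * w (Set.range Φ) * ((w univ)⁻¹ * w (Up (Φ '' A)))) :=
        mul_le_mul' le_rfl hq
    _ = ((w (Set.range Φ))⁻¹ * w (Set.range Φ)) * ((w univ)⁻¹ * w univ) *
          ((w univ)⁻¹ * w (Up (Φ '' A))) := by ring
    _ = (w univ)⁻¹ * w (Up (Φ '' A)) := by
        rw [ENNReal.inv_mul_cancel hE0 hEtop, ENNReal.inv_mul_cancel hU0 hUtop, one_mul, one_mul]
    _ ≤ (w univ)⁻¹ * w T := mul_le_mul' le_rfl hmono

end Summit.CriticalPhenomena.SAWScalingLimit.Cruxes.DomainMonotone.Birth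

end
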